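import Summits.Ventures.PercRepro.ThetaTwoPairs
import Summits.Ventures.PercRepro.ThetaBridge

/-!
# (Θ) with at most two pairs of some type, modulo the weaker Conjecture V-2

`ThetaTwoPairs.lean` proves the set-world coloured Marica–Schönheim statement (Θ) whenever some
type has at most two pairs, modulo **Conjecture V** (`ConjV`): the block structure of every
MS-excess-1 family with a near-member and no tight one-point extension. Conjecture V is only used
at the very last step of that proof, and only through the block lemmas
`eq_of_diffs_eq_insert_empty` / `_compl`, which turn the block structure into the equality
`u' = u` of the two pairs. This file isolates what that last step really needs:

**Conjecture V-2** (`ConjV2`): if an MS-excess-1 family `F` (disjoint from its complement family)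
has two near-members `u`, `u'` for the *same* sign pattern, with `u \ u'` and `u' \ u` among its
differences and with neither `F ∪ {u}` nor `F ∪ {uᶜ}` tight, then `u' = u` or `u' = uᶜ`.

Conjecture V implies Conjecture V-2 (`conjV2_of_conjV`, the block step), and V-2 suffices for the
whole chain: `theta_card_le_of_card_le_two_of_conjV2`, `theta_card_le_of_some_card_le_two_of_conjV2`
and the typed form `PercRepro.cycleMS_of_some_card_le_two_of_conjV2` (CYCLE-MS′). Census (own code,
pruned DFS, mining/mine-1/g9/vtwo.c): on [4] ≤ 8, [5] ≤ 8, [6] ≤ 9, [7] ≤ 7, [8] ≤ 5 every pair of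
simultaneous near-members of an excess-1 family is nested, never has both `u \ u'`, `u' \ u` among
the differences, and never involves a residue instance — the hypotheses of V-2 are never met.
-/

namespace PercRepro.MSTight

open Finset
open scoped FinsetFamily

variable {α : Type*} [DecidableEq α] [Fintype α]

omit [Fintype α] in
/-- For a family of MS-excess one and a set `u ∉ F`, the one-point extension `F ∪ {u}` is tight
iff every difference between `u` and a member of `F` is already a difference of `F`. This makes
the two `¬ Tight` hypotheses of `ConjV` and `ConjV2` transparent: `F ∪ {u}` is not tight iff some
member `t` has `u \ t ∉ F \\ F` or `t \ u ∉ F \\ F`, i.e. some member carries the agreement cells of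
`u` but not its disagreement cells. -/
theorem tight_insert_iff_of_excess_one {F : Finset (Finset α)} {u : Finset α}
    (hex : (F \\ F).card = F.card + 1) (hu : u ∉ F) :
    Tight (insert u F) ↔ ∀ t ∈ F, u \ t ∈ F \\ F ∧ t \ u ∈ F \\ F := by
  have hsub : F \\ F ⊆ insert u F \\ insert u F :=
    diffs_subset (subset_insert _ _) (subset_insert _ _)
  have hcard : (insert u F).card = F.card + 1 := card_insert_of_notMem hu
  obtain ⟨t₀, ht₀⟩ : F.Nonempty := by
    by_contra hemp
    rw [not_nonempty_iff_eq_empty] at hemp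
    subst hemp
    simp at hex
  have h0 : (∅ : Finset α) ∈ F \\ F := mem_diffs.2 ⟨t₀, ht₀, t₀, ht₀, Finset.sdiff_self t₀⟩
  constructor
  · intro hT
    have heq : insert u F \\ insert u F = F \\ F := by
      symm
      apply eq_of_subset_of_card_le hsub
      unfold Tight at hT
      omega
    intro t ht
    refine ⟨?_, ?_⟩
    · rw [← heq]; exact mem_diffs.2 ⟨u, mem_insert_self _ _, t, mem_insert_of_mem ht, rfl⟩
    · rw [← heq]; exact mem_diffs.2 ⟨t, mem_insert_of_mem ht, u, mem_insert_self _ _, rfl⟩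
  · intro hall
    have heq : insert u F \\ insert u F = F \\ F := by
      refine Subset.antisymm ?_ hsub
      rw [diffs_subset_iff]
      intro a ha b hb
      rcases mem_insert.1 ha with hau | haF
      · rcases mem_insert.1 hb with hbu | hbF
        · rw [hau, hbu, Finset.sdiff_self]; exact h0
        · rw [hau]; exact (hall b hbF).1
      · rcases mem_insert.1 hb with hbu | hbF
        · rw [hbu]; exact (hall a haF).2
        · exact mem_diffs.2 ⟨a, haF, b, hbF, rfl⟩
    unfold Tight
    rw [heq, hex, hcard]

/-- **Conjecture V-2** (candidate proposition, never asserted): two near-members `u`, `u'` of an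
MS-excess-1 family `F` (disjoint from its complement family) for the same sign pattern `σ`, with
`u \ u'` and `u' \ u` among the differences of `F` and with neither `F ∪ {u}` nor `F ∪ {uᶜ}`
tight, satisfy `u' = u` or `u' = uᶜ`. This is exactly the residue of the «≤ 2 pairs» argument
of `ThetaTwoPairs.lean`; Conjecture V implies it (`conjV2_of_conjV`). -/
def ConjV2 (α : Type*) [DecidableEq α] [Fintype α] : Prop :=
  ∀ (F : Finset (Finset α)) (σ : Finset α → Bool) (u u' : Finset α),
    Disjoint F (compls F) → (F \\ F).card = F.card + 1 →
    u ∉ F → Finset.univ \ u ∉ F → u' ∉ F → Finset.univ \ u' ∉ F →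
    (∀ t ∈ F, Cells (F \\ F) t (if σ t = true then u else Finset.univ \ u)) →
    (∀ t ∈ F, Cells (F \\ F) t (if σ t = true then u' else Finset.univ \ u')) →
    u \ u' ∈ F \\ F → u' \ u ∈ F \\ F →
    ¬ Tight (insert u F) → ¬ Tight (insert (Finset.univ \ u) F) →
    u' = u ∨ Finset.univ \ u' = u

/-- **Conjecture V implies Conjecture V-2** — the block step of `ThetaTwoPairs.lean`: a block
family (or the mirror of one) with two near-members `u`, `u'` whose mutual differences are
differences of the family forces `u' = u`. -/
theorem conjV2_of_conjV (hV : ConjV α) : ConjV2 α := by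
  intro F σ u u' hdisj hex hu1 hu2 hu1' hu2' hcu hcu' hxD hyD ht1 ht2
  rcases hV F σ u hdisj hex hu1 hu2 hcu ht1 ht2 with hblock | hblock
  · exact Or.inl (eq_of_diffs_eq_insert_empty hblock σ hu1 hu2 hu1' hu2' hcu hcu' hxD hyD)
  · exact Or.inl (eq_of_diffs_eq_insert_empty_compl hblock σ hu1 hu2 hu1' hu2' hcu hcu' hxD hyD)

/-- **(Θ) with at most two pairs of the middle type, modulo Conjecture V-2** (the proof of
`theta_card_le_of_card_le_two_of_conjV` with the block step replaced by the bare residue). -/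
theorem theta_card_le_of_card_le_two_of_conjV2 (hV2 : ConjV2 α) {A B C : Finset (Finset α)}
    (h : ThetaValid A B C) (hB : B.card ≤ 2) :
    A.card + B.card + C.card ≤ (thetaD A B C).card := by
  rcases Nat.lt_or_ge B.card 2 with hlt | hge
  · exact theta_card_le_of_card_le_one h (by omega)
  have hB2 : B.card = 2 := le_antisymm hB hge
  obtain ⟨u, u', huu', hBeq⟩ := card_eq_two.1 hB2
  have hu : u ∈ B := by rw [hBeq]; exact mem_insert_self _ _
  have hu' : u' ∈ B := by rw [hBeq]; exact mem_insert_of_mem (mem_singleton_self _)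
  rw [hB2]
  by_contra hlt
  push Not at hlt
  set F := transversal A C with hFdef
  set D := thetaD A B C with hDdef
  have hcardF : F.card = A.card + C.card := card_transversal (B := B) h
  -- the one-pair sub-instances fill `D` exactly
  have sub1 : ∀ v ∈ B, D.card = A.card + C.card + 1 := by
    intro v hv
    have hval := thetaValid_singleton h hv
    have hreg := theta_card_le_of_card_le_one hval (by simp)
    rw [card_singleton] at hreg
    have hsub : thetaD A {v} C ⊆ D := thetaD_mono_mid (singleton_subset_iff.2 hv)
    have := card_le_card hsub
    omega
  have hDcard := sub1 u hu
  have hFD : F \\ F ⊆ D := diffs_transversal_subset A B C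
  have hMS : F.card ≤ (F \\ F).card := Finset.card_le_card_diffs F
  have hFDc : (F \\ F).card ≤ D.card := card_le_card hFD
  have hcu : ∀ t ∈ F, Cells D t (if decide (t ∈ A) = true then u else Finset.univ \ u) :=
    cells_mem_thetaD_signed hu
  have hcu' : ∀ t ∈ F, Cells D t (if decide (t ∈ A) = true then u' else Finset.univ \ u') :=
    cells_mem_thetaD_signed hu'
  have hxD : u \ u' ∈ D := mem_thetaD_of_mem_diffs_mid (mem_diffs.2 ⟨u, hu, u', hu', rfl⟩)
  have hyD : u' \ u ∈ D := mem_thetaD_of_mem_diffs_mid (mem_diffs.2 ⟨u', hu', u, hu, rfl⟩)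
  obtain ⟨hu1, hu2⟩ : u ∉ F ∧ Finset.univ \ u ∉ F := notMem_transversal h hu
  obtain ⟨hu1', hu2'⟩ : u' ∉ F ∧ Finset.univ \ u' ∉ F := notMem_transversal h hu'
  have hne_compl : Finset.univ \ u' ≠ u := by
    intro heq
    have : u ∈ compls B := heq ▸ compl_mem_compls hu'
    exact disjoint_left.1 h.2.1 hu this
  have h0D : (∅ : Finset α) ∈ D :=
    mem_thetaD_of_mem_diffs_mid (mem_diffs.2 ⟨u, hu, u, hu, Finset.sdiff_self u⟩)
  -- the transversal is nonempty: otherwise `D` would have one element but contains `∅` and a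
  -- nonempty difference of `u`, `u'`
  have hFne : F.Nonempty := by
    by_contra hemp
    rw [not_nonempty_iff_eq_empty] at hemp
    rw [hemp, card_empty] at hcardF
    have hD1 : D.card = 1 := by omega
    have hxy : u \ u' ≠ ∅ ∨ u' \ u ≠ ∅ := by
      by_contra hcon
      push Not at hcon
      exact huu' (Finset.Subset.antisymm (sdiff_eq_empty_iff_subset.1 hcon.1)
        (sdiff_eq_empty_iff_subset.1 hcon.2))
    have two : ∀ z ∈ D, z ≠ ∅ → 2 ≤ D.card := by
      intro z hz hzne
      calc 2 = ({∅, z} : Finset (Finset α)).card := (card_pair (Ne.symm hzne)).symm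
        _ ≤ D.card := card_le_card (by
          intro w hw
          rcases mem_insert.1 hw with rfl | hw
          · exact h0D
          · rw [mem_singleton.1 hw]; exact hz)
    rcases hxy with hx | hy
    · have := two _ hxD hx; omega
    · have := two _ hyD hy; omega
  by_cases hT : Tight F
  · -- `F` tight: `D = insert e (F \\ F)` with a single defect `e`, and Lemma U
    have hcardD : (F \\ F).card < D.card := by unfold Tight at hT; omega
    obtain ⟨e, heD, heF⟩ := exists_mem_notMem_of_card_lt_card hcardD
    have hDeq : D = insert e (F \\ F) := by
      symm
      apply eq_of_subset_of_card_le
      · intro z hz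
        rcases mem_insert.1 hz with rfl | hz
        · exact heD
        · exact hFD hz
      · rw [card_insert_of_notMem heF]
        unfold Tight at hT
        omega
    rw [hDeq] at hcu hcu'
    exact huu' (eq_of_cells_subset_insert hT hFne (fun t => decide (t ∈ A)) heF hu1 hu2 hu1' hu2'
      hcu hcu').symm
  · -- `F` has excess exactly one and `F \\ F = D`
    have hex : (F \\ F).card = F.card + 1 := by unfold Tight at hT; omega
    have hDF : F \\ F = D := eq_of_subset_of_card_le hFD (by omega)
    rw [← hDF] at hcu hcu' hxD hyD
    by_cases ht1 : Tight (insert u F)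
    · have hsub : F \\ F ⊆ insert u F \\ insert u F :=
        diffs_subset (subset_insert _ _) (subset_insert _ _)
      rcases mem_or_compl_mem_of_tight_insert ht1 (fun t => decide (t ∈ A))
          (fun t ht => cells_mono hsub (hcu' t ht)) (hsub hxD) (hsub hyD) with h' | h'
      · rcases mem_insert.1 h' with h'' | h''
        · exact huu' h''.symm
        · exact hu1' h''
      · rcases mem_insert.1 h' with h'' | h''
        · exact hne_compl h''
        · exact hu2' h''
    by_cases ht2 : Tight (insert (Finset.univ \ u) F)
    · have hsub : F \\ F ⊆ insert (Finset.univ \ u) F \\ insert (Finset.univ \ u) F :=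
        diffs_subset (subset_insert _ _) (subset_insert _ _)
      rcases mem_or_compl_mem_of_tight_insert_compl ht2 (fun t => decide (t ∈ A))
          (fun t ht => cells_mono hsub (hcu' t ht)) (hsub hxD) (hsub hyD) with h' | h'
      · rcases mem_insert.1 h' with h'' | h''
        · exact hne_compl (by rw [h'', Finset.sdiff_sdiff_eq_self (subset_univ u)])
        · exact hu1' h''
      · rcases mem_insert.1 h' with h'' | h''
        · exact huu' (by
            have := congrArg (fun s => Finset.univ \ s) h''
            simpa [Finset.sdiff_sdiff_eq_self (subset_univ u), Finset.sdiff_sdiff_eq_self (subset_univ u')]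
              using this.symm)
        · exact hu2' h''
    -- the residue: Conjecture V-2 verbatim
    have hdisj := disjoint_transversal_compls (B := B) h
    rcases hV2 F (fun t => decide (t ∈ A)) u u' hdisj hex hu1 hu2 hu1' hu2' hcu hcu' hxD hyD ht1 ht2
      with h' | h'
    · exact huu' h'.symm
    · exact hne_compl h'

/-- **(Θ) whenever some type has at most two pairs, modulo Conjecture V-2.** -/
theorem theta_card_le_of_some_card_le_two_of_conjV2 (hV2 : ConjV2 α) {A B C : Finset (Finset α)}
    (h : ThetaValid A B C) (hsmall : A.card ≤ 2 ∨ B.card ≤ 2 ∨ C.card ≤ 2) :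
    A.card + B.card + C.card ≤ (thetaD A B C).card := by
  rcases hsmall with hA | hB | hC
  · have := theta_card_le_of_card_le_two_of_conjV2 hV2 (thetaValid_rotate (thetaValid_rotate h)) hA
    rw [thetaD_rotate, thetaD_rotate] at this
    omega
  · exact theta_card_le_of_card_le_two_of_conjV2 hV2 h hB
  · have := theta_card_le_of_card_le_two_of_conjV2 hV2 (thetaValid_rotate h) hC
    rw [thetaD_rotate] at this
    omega

end PercRepro.MSTight

namespace PercRepro

open Finset

variable {S : Type} [Fintype S] [DecidableEq S]

/-- **CYCLE-MS′ whenever some type has at most two pairs, modulo Conjecture V-2** (the typed form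
of `MSTight.theta_card_le_of_some_card_le_two_of_conjV2`). -/
theorem cycleMS_of_some_card_le_two_of_conjV2 (hV2 : MSTight.ConjV2 S) (A B C : Finset (Config S))
    (hd : [A, B, C, famCompl A, famCompl B, famCompl C].Pairwise Disjoint)
    (hsmall : A.card ≤ 2 ∨ B.card ≤ 2 ∨ C.card ≤ 2) :
    A.card + B.card + C.card ≤ (famD A B C).card := by
  have h := MSTight.theta_card_le_of_some_card_le_two_of_conjV2 hV2 (thetaValid_of_pairwise hd)
    (by simpa [card_image_toFinset] using hsmall)
  rw [← image_toFinset_famD, card_image_toFinset, card_image_toFinset, card_image_toFinset,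
    card_image_toFinset] at h
  exact h

end PercRepro
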